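import Summits.ResolutionOfSingularities.ResolutionOfSingularities.Theorems.MarkedTransferCampaignW25FiniteRaySB
import Summits.ResolutionOfSingularities.ResolutionOfSingularities.Theorems.MarkedTransferCampaignW25FiniteABRay
import Literature.AlgebraicGeometry.Hironaka2017.Proofs.S08UnitMonomial.U46L29TopFrame
import HarnessLib

/-!
# K2.5 record, carrier SB, SECOND model of `M_<` (p502315 `CampaignW25.MemBelowSpan`): the TOTAL-DEGREE cell is NO,
# and `CampaignW25.K25Reduction 2 1 ℓ E_SB` is false — slot W2.5 = L-47B-s3 (DEAD on SW; NOT touched here)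

[OURS · L W2.5 · K2.5 record · typer-of-record after-care, counted 0] HIRONAKA CAMPAIGN D-0089, ladder L, group G2 (§9
`H♭`), GAP row R47 (B) (Lemma 9.5 p.50 l.11–14, COUPLED depth choice). Companion of `MarkedTransferCampaignW25FiniteRaySBSpan.lean`
(same seat: under the SECOND model of `M_<` — p502315's `ρ^ℓ`-SPAN of the monomials below the ray, same-pair monomials
`<lex` every ray member included — the BOX form of res-adj-2's (β) question on SB = `Σ_{k≥1} ω₁^{2k}ω₂³` (res-type-055
`Lem95CoupledBox`, p491132) is YES). THIS FILE: the TOTAL-DEGREE form (k25's `SW.AdmissibleTop`: `|qγ_j| < p^ℓ` on the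
top block) stays NO under the span model at every depth `ℓ ≥ 2`, and p502315's by-name question
`CampaignW25.K25Reduction 2 1 ℓ E_SB` (finite `rayOf` + total degree + span model) is FALSE — the SB twin of res-L1-k25's
`CampaignW25.SWReduction.not_K25Reduction'` (p505154).

ROUTE (`E_SB = toFin 𝔽 2 εB ∈ 𝔽₂⟦x₀, x₁, x₂⟧`, `x₀ = y`, `p = 2`, `e = 1`). A generator of `M_<^span` over `(e₂, 0)` and the
ray `{(0,k,1) : k ≥ 1}` of `E_SB` is `s · x^{a + 2c}`, `s ∈ ρ^ℓ`, with EITHER `a = 0` OR `a = e₂` and `c <lex (0,1,1)`, i.e.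
`c ∈ {(0,0,j)} ∪ {(0,1,0)}` (`digits_of_isBelowRay`); so no element of `M_<^span` carries `m_* = ω₁^{2^ℓ−2} ω₂³`, `ℓ ≥ 2`
(`coeff_rayMonoSB_eq_zero`: `a = 0` gives an even `ω₂`-exponent, `c = (0,0,j)` forces `2^ℓ ∣ 2^ℓ − 2`, `c = (0,1,0)` forces
`2^ℓ ∣ 2`). Hence `coeff m_* ε′ = 1` for every `ε′ ≡ E_SB (mod M_<^span)`; the term of a depth-`ℓ` expression `X′` carrying
`m_*` is `(e₂, 0, (0, 2^{ℓ−1}−1, 1))` itself; every effective term has `a ∈ {0, e₂}` (parity via the visible member of its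
residue class), so `(α, β)(X′) = (e₂, 0)` and that term is a TOP-BLOCK member with `|2c| = 2^ℓ = p^ℓ`
(`exists_topBlock_degree_ge`) — inside the Frobenius box, outside the total-degree bound. Corollaries:
`not_existsAdmissibleFiniteRay_span`, `not_K25Reduction` (a depth-`ℓ` expression of `E_SB` exists by res-D-pv-041's
`nonempty_standardExpression_topFrame`), `ℓ = 3, 4`. TRUTH TABLE of the (β) cell on SB after both files: registered model
(k25 p502943) × (box | total) = NO | NO (p505387); span model (p502315) × box = YES, × total = NO. K25 = DEAD (SW, registered
model) and every GAP-LEDGER word are untouched; no verdict is worded here (res-adj-2's). Nothing of H. Hironaka's manuscript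
[Hironaka2017] (lit key `paper:url-3343fd9e678b`, «under review», D-0012/D-0089) is asserted. Typed by res-type-054;
AI-written, weaker than expert review. References: H. Hironaka, ms. 2017-03-23, Eq. (76)/(77) p.49, Lem. 9.5 p.50 l.11–15
(UNDER ADJUDICATION). [Hironaka2017] -/

-- `Summit.<Summit>.<Sub>.Theorems` with `Sub = Summit` (single-conjunct summit, D-0017)
set_option linter.dupNamespace false

noncomputable section

namespace Summit.ResolutionOfSingularities.ResolutionOfSingularities.Theorems.CampaignW25.SBSpanTotal

open MvPowerSeries Finset
open Literature.AlgebraicGeometry.Hironaka2017.S09LLUED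
open Literature.AlgebraicGeometry.Hironaka2017.S09LLUED.TopFrontier
open Literature.AlgebraicGeometry.Hironaka2017.S09LLUED.Lem95Coupled
  (toFin exists_mem_effSupport_of_coeff_ne_zero' exists_coeff_ne_zero_modEq_of_mem_effSupport)
open Literature.AlgebraicGeometry.Hironaka2017.S09LLUED.Lem95CoupledBox (εB coeff_E)
open Literature.AlgebraicGeometry.Hironaka2017.S08UnitMonomial
  (StandardExpression frobPow nonempty_standardExpression_topFrame)
open Literature.AlgebraicGeometry.Hironaka2017.S07Permissible.Cor720Countermodel (𝔽)
open Summit.ResolutionOfSingularities.ResolutionOfSingularities.Theorems.CampaignW25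
  (ray rayOf IsBelowRay MemBelowSpan DerivOrdersBelowDepth K25Reduction)
open Summit.ResolutionOfSingularities.ResolutionOfSingularities.Theorems.CampaignW25.SW
  (toLex_lt_single_two_iff AdmissibleTop snd_fst_eq_zero)

/-! ## §1 The generators of `M_<^span` on SB -/

/-- `0 ≠ 1` in `Fin 3`. [folklore] -/
private theorem n01 : (0 : Fin 3) ≠ 1 := by decide
/-- `0 ≠ 2` in `Fin 3`. [folklore] -/
private theorem n02 : (0 : Fin 3) ≠ 2 := by decide
/-- `1 ≠ 2` in `Fin 3`. [folklore] -/
private theorem n12 : (1 : Fin 3) ≠ 2 := by decide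
/-- `2 ≠ 1` in `Fin 3`. [folklore] -/
private theorem n21 : (2 : Fin 3) ≠ 1 := by decide

/-- `(0, 1, 1)` is a ray member of `E_SB` over `(e₂, 0)` (`coeff ω₁²ω₂³ = 1`, `k = 1`). [folklore] -/
theorem single_add_single_mem_ray :
    Finsupp.single (1 : Fin 3) 1 + Finsupp.single 2 1 ∈ ray 2 1 (Finsupp.single (2 : Fin 3) 1) 0 (toFin 𝔽 2 εB) := by
  show coeff _ _ ≠ 0
  rw [coeff_E, if_pos]
  · exact one_ne_zero
  · simp [Finsupp.add_apply, Finsupp.single_eq_of_ne n01, Finsupp.single_eq_of_ne n02,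
      Finsupp.single_eq_of_ne n12, Finsupp.single_eq_of_ne n21]

/-- Nothing is `<lex 0` on `ℕ³`. [folklore] -/
private theorem not_toLex_lt_zero (f : Fin 3 →₀ ℕ) : ¬ toLex f < toLex (0 : Fin 3 →₀ ℕ) :=
  not_lt.2 (Finsupp.toLex_monotone (by intro i; simp))

/-- **Digits of a generator below the ray on SB** (span model): `b = 0`, and EITHER `a = 0` OR `a = e₂` with
`c <lex (0,1,1)`, i.e. `c₀ = 0` and (`c₁ = 0` or `c₁ = 1, c₂ = 0`). [folklore] -/
theorem digits_of_isBelowRay {t : ExpTriple 3} (hb : ∀ i, t.2.1 i < 2 ^ (1 - 1))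
    (ht : IsBelowRay (Finsupp.single (2 : Fin 3) 1) 0 (ray 2 1 (Finsupp.single (2 : Fin 3) 1) 0 (toFin 𝔽 2 εB)) t) :
    t.2.1 = 0 ∧ (t.1 = 0 ∨ (t.1 = Finsupp.single 2 1 ∧ t.2.2 0 = 0 ∧
      (t.2.2 1 = 0 ∨ (t.2.2 1 = 1 ∧ t.2.2 2 = 0)))) := by
  have hb0 : t.2.1 = 0 := by
    ext j
    have h := hb j
    simp only [Nat.sub_self, pow_zero, Nat.lt_one_iff] at h
    rw [h, Finsupp.zero_apply]
  refine ⟨hb0, ?_⟩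
  rcases ht with hlt | ⟨h1, -, hall⟩
  · left
    unfold pairKey at hlt
    rw [Prod.Lex.toLex_lt_toLex] at hlt
    rcases hlt with h | ⟨-, h⟩
    · exact (toLex_lt_single_two_iff t.1).1 h
    · exact absurd (hb0 ▸ h) (not_toLex_lt_zero _)
  · right
    refine ⟨h1, ?_⟩
    have h := hall _ single_add_single_mem_ray
    obtain ⟨i, hi, hlt⟩ := Finsupp.Lex.lt_iff.1 h
    fin_cases i
    · simp [Finsupp.single_eq_of_ne n01, Finsupp.single_eq_of_ne n02] at hlt
    · have h0 := hi 0 (by decide)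
      simp only [ofLex_toLex, Finsupp.add_apply, Finsupp.single_eq_of_ne n01, Finsupp.single_eq_of_ne n02,
        add_zero] at h0
      simp only [Fin.mk_one, ofLex_toLex, Finsupp.add_apply, Finsupp.single_eq_same,
        Finsupp.single_eq_of_ne n12, add_zero, Nat.lt_one_iff] at hlt
      exact ⟨h0, Or.inl hlt⟩
    · have h0 := hi 0 (by decide)
      have h1' := hi 1 (by decide)
      simp only [ofLex_toLex, Finsupp.add_apply, Finsupp.single_eq_of_ne n01, Finsupp.single_eq_of_ne n02,
        add_zero] at h0
      simp only [ofLex_toLex, Finsupp.add_apply, Finsupp.single_eq_same, Finsupp.single_eq_of_ne n12,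
        add_zero] at h1'
      simp only [Fin.reduceFinMk, ofLex_toLex, Finsupp.add_apply, Finsupp.single_eq_same,
        Finsupp.single_eq_of_ne n21, zero_add, Nat.lt_one_iff] at hlt
      exact ⟨h0, Or.inr ⟨h1', hlt⟩⟩

/-- **Monomials of an element of `M_<^span`**: if `coeff m f ≠ 0` then `m = a_t + 2c_t + 2^ℓ k` for some generator `t`
below the ray (with its digit data). [folklore] -/
theorem exists_gen_of_coeff_ne_zero {ℓ : ℕ} {f : MvPowerSeries (Fin 3) 𝔽}
    (hf : MemBelowSpan 2 1 ℓ (Finsupp.single (2 : Fin 3) 1) 0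
      (ray 2 1 (Finsupp.single (2 : Fin 3) 1) 0 (toFin 𝔽 2 εB)) f)
    {m : Fin 3 →₀ ℕ} (hm : coeff m f ≠ 0) :
    ∃ (t : ExpTriple 3) (k : Fin 3 →₀ ℕ), (∀ i, t.1 i < 2) ∧ t.2.1 = 0 ∧
      (t.1 = 0 ∨ (t.1 = Finsupp.single 2 1 ∧ t.2.2 0 = 0 ∧ (t.2.2 1 = 0 ∨ (t.2.2 1 = 1 ∧ t.2.2 2 = 0)))) ∧
        m = t.1 + 2 • t.2.1 + 2 ^ 1 • t.2.2 + 2 ^ ℓ • k := by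
  classical
  obtain ⟨T, s, hT, rfl⟩ := hf
  rw [map_sum] at hm
  obtain ⟨t, htT, hne⟩ := Finset.exists_ne_zero_of_sum_ne_zero hm
  obtain ⟨ha, hb, hbelow, hs⟩ := hT t htT
  rw [mono_X_eq_monomial, mul_comm] at hne
  obtain ⟨k, hk⟩ := exists_eq_add_smul_of_coeff_ne_zero (isSupportedOnMultiples_of_mem_frobPow 2 hs) hne
  obtain ⟨hb0, hdig⟩ := digits_of_isBelowRay hb hbelow
  exact ⟨t, k, ha, hb0, hdig, hk⟩

/-- **Parity**: every monomial of an element of `M_<^span` has even `y`- and `ω₁`-exponents (`ℓ ≥ 1`). [folklore] -/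
theorem two_dvd_of_coeff_ne_zero {ℓ : ℕ} (hℓ : 1 ≤ ℓ) {f : MvPowerSeries (Fin 3) 𝔽}
    (hf : MemBelowSpan 2 1 ℓ (Finsupp.single (2 : Fin 3) 1) 0
      (ray 2 1 (Finsupp.single (2 : Fin 3) 1) 0 (toFin 𝔽 2 εB)) f)
    {m : Fin 3 →₀ ℕ} (hm : coeff m f ≠ 0) : 2 ∣ m 0 ∧ 2 ∣ m 1 := by
  obtain ⟨t, k, -, hb0, hdig, hk⟩ := exists_gen_of_coeff_ne_zero hf hm
  have ha0 : t.1 0 = 0 := by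
    rcases hdig with h | ⟨h, -⟩
    · rw [h, Finsupp.zero_apply]
    · rw [h, Finsupp.single_eq_of_ne n02]
  have ha1 : t.1 1 = 0 := by
    rcases hdig with h | ⟨h, -⟩
    · rw [h, Finsupp.zero_apply]
    · rw [h, Finsupp.single_eq_of_ne n12]
  obtain ⟨z, hz⟩ : ∃ z, 2 ^ ℓ = 2 * z := ⟨2 ^ (ℓ - 1), by rw [← pow_succ', Nat.sub_add_cancel hℓ]⟩
  have h0 := DFunLike.congr_fun hk 0
  have h1 := DFunLike.congr_fun hk 1
  simp only [Finsupp.add_apply, Finsupp.smul_apply, smul_eq_mul, hb0, Finsupp.coe_zero, Pi.zero_apply, mul_zero,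
    add_zero, pow_one, ha0, ha1, zero_add, hz] at h0 h1
  exact ⟨⟨t.2.2 0 + z * k 0, by rw [h0]; ring⟩, ⟨t.2.2 1 + z * k 1, by rw [h1]; ring⟩⟩

/-! ## §2 The ray monomial `m_* = ω₁^{2^ℓ − 2} ω₂³` of `E_SB` is untouched by `M_<^span` (`ℓ ≥ 2`) -/

/-- **`coeff m_* f = 0` for every `f ∈ M_<^span`**, `m_* = (0, 2^ℓ − 2, 3)`, `ℓ ≥ 2`. [folklore] -/
theorem coeff_rayMonoSB_eq_zero {ℓ : ℕ} (hℓ : 2 ≤ ℓ) {f : MvPowerSeries (Fin 3) 𝔽}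
    (hf : MemBelowSpan 2 1 ℓ (Finsupp.single (2 : Fin 3) 1) 0
      (ray 2 1 (Finsupp.single (2 : Fin 3) 1) 0 (toFin 𝔽 2 εB)) f) :
    coeff (Finsupp.single (1 : Fin 3) (2 ^ ℓ - 2) + Finsupp.single 2 3) f = 0 := by
  by_contra hne
  obtain ⟨t, k, ha, hb0, hdig, hk⟩ := exists_gen_of_coeff_ne_zero hf hne
  have h4 : 4 ≤ 2 ^ ℓ := le_trans (by norm_num : 4 ≤ 2 ^ 2) (Nat.pow_le_pow_right (by norm_num) hℓ)
  have e1 : 2 ^ ℓ - 2 = t.1 1 + 2 * t.2.2 1 + 2 ^ ℓ * k 1 := by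
    have h := DFunLike.congr_fun hk 1
    simpa only [Finsupp.add_apply, Finsupp.smul_apply, smul_eq_mul, hb0, Finsupp.coe_zero, Pi.zero_apply, mul_zero,
      add_zero, pow_one, Finsupp.single_eq_same, Finsupp.single_eq_of_ne n12] using h
  have e2 : 3 = t.1 2 + 2 * t.2.2 2 + 2 ^ ℓ * k 2 := by
    have h := DFunLike.congr_fun hk 2
    simpa only [Finsupp.add_apply, Finsupp.smul_apply, smul_eq_mul, hb0, Finsupp.coe_zero, Pi.zero_apply, mul_zero,
      add_zero, pow_one, Finsupp.single_eq_same, Finsupp.single_eq_of_ne n21, zero_add] using h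
  obtain ⟨z2, hz2⟩ : ∃ z, 2 ^ ℓ * k 2 = 2 * z := Dvd.dvd.mul_right (dvd_pow_self 2 (by omega)) _
  rcases hdig with h0 | ⟨h1, -, hc⟩
  · -- `a = 0`: the `ω₂`-exponent of the generator's monomials is even, `3` is odd
    rw [h0, Finsupp.coe_zero, Pi.zero_apply, zero_add] at e2
    omega
  · rw [h1] at e1 e2
    rw [Finsupp.single_eq_of_ne n12, zero_add] at e1
    rw [Finsupp.single_eq_same] at e2
    rcases hc with hc1 | ⟨hc1, hc2⟩
    · -- `c = (0,0,j)`: coordinate 1 reads `2^ℓ − 2 = 2^ℓ k₁`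
      rw [hc1, mul_zero, zero_add] at e1
      rcases Nat.eq_zero_or_pos (k 1) with hk0 | hkp
      · rw [hk0, mul_zero] at e1
        omega
      · have : 2 ^ ℓ ≤ 2 ^ ℓ * k 1 := Nat.le_mul_of_pos_right _ hkp
        omega
    · -- `c = (0,1,0)`: coordinate 2 reads `3 = 1 + 2^ℓ k₂`
      rw [hc2, mul_zero, add_zero] at e2
      rcases Nat.eq_zero_or_pos (k 2) with hk0 | hkp
      · rw [hk0, mul_zero] at e2
        omega
      · have : 2 ^ ℓ ≤ 2 ^ ℓ * k 2 := Nat.le_mul_of_pos_right _ hkp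
        omega

/-! ## §3 Every standard expression of every `ε′ ≡ E_SB (mod M_<^span)` -/

section StdExpr

variable {ℓ : ℕ} {ε' : MvPowerSeries (Fin 3) 𝔽}
  (hB : MemBelowSpan 2 1 ℓ (Finsupp.single (2 : Fin 3) 1) 0
    (ray 2 1 (Finsupp.single (2 : Fin 3) 1) 0 (toFin 𝔽 2 εB)) (toFin 𝔽 2 εB - ε'))
  (X : StandardExpression 2 MvPowerSeries.X 1 ℓ ε')

include hB in
/-- `coeff m_* ε′ = 1` (`m_* = ω₁^{2^ℓ−2} ω₂³`, `ℓ ≥ 2`): `M_<^span` cannot touch it. [folklore] -/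
theorem coeff_rayMonoSB_eq_one (hℓ : 2 ≤ ℓ) :
    coeff (Finsupp.single (1 : Fin 3) (2 ^ ℓ - 2) + Finsupp.single 2 3) ε' = 1 := by
  have h4 : 4 ≤ 2 ^ ℓ := le_trans (by norm_num : 4 ≤ 2 ^ 2) (Nat.pow_le_pow_right (by norm_num) hℓ)
  have hpow : 2 ^ ℓ = 2 * 2 ^ (ℓ - 1) := by rw [← pow_succ', Nat.sub_add_cancel (by omega : 1 ≤ ℓ)]
  have h := coeff_rayMonoSB_eq_zero hℓ hB
  rw [map_sub, sub_eq_zero] at h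
  rw [← h, coeff_E, if_pos]
  simp only [Finsupp.add_apply, Finsupp.single_eq_same, Finsupp.single_eq_of_ne n01, Finsupp.single_eq_of_ne n02,
    Finsupp.single_eq_of_ne n12, Finsupp.single_eq_of_ne n21, add_zero, zero_add]
  exact ⟨trivial, ⟨2 ^ (ℓ - 1) - 1, by omega⟩, by omega, trivial⟩

include hB in
/-- **Parity of the monomials of `ε′`** (`ℓ ≥ 1`): even `y`- and `ω₁`-exponents (those of `E_SB` are `(0, 2k, 3)`, those of
the difference come from `M_<^span`). [folklore] -/
theorem two_dvd_of_coeff_ne_zero' (hℓ : 1 ≤ ℓ) {m : Fin 3 →₀ ℕ} (hm : coeff m ε' ≠ 0) : 2 ∣ m 0 ∧ 2 ∣ m 1 := by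
  by_cases hE : coeff m (toFin 𝔽 2 εB) = 0
  · have hsub : coeff m (toFin 𝔽 2 εB - ε') ≠ 0 := by
      rw [map_sub, hE, zero_sub, neg_ne_zero]
      exact hm
    exact two_dvd_of_coeff_ne_zero hℓ hB hsub
  · rw [coeff_E] at hE
    split_ifs at hE with hc
    · exact ⟨by rw [hc.1]; exact dvd_zero 2, hc.2.1⟩
    · exact absurd rfl hE

include hB in
/-- **Shape of the effective terms**: `b = 0`, `a₀ = a₁ = 0` (so `a ∈ {0, e₂}`), via the visible member of the residue
class (res-type-055's `exists_coeff_ne_zero_modEq_of_mem_effSupport`). [folklore] -/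
theorem shape_of_mem_effSupport' (hℓ : 1 ≤ ℓ) {t : ExpTriple 3} (ht : t ∈ effSupport X.support X.u) :
    t.2.1 = 0 ∧ t.1 0 = 0 ∧ t.1 1 = 0 := by
  have hb : t.2.1 = 0 := snd_fst_eq_zero X (effSupport_subset _ _ ht)
  obtain ⟨s, hs, hs1, -, -, hcoeff⟩ := exists_coeff_ne_zero_modEq_of_mem_effSupport le_rfl hℓ X ht
  have hsb : s.2.1 = 0 := snd_fst_eq_zero X (effSupport_subset _ _ hs)
  have ha0 := X.a_lt s (effSupport_subset _ _ hs) 0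
  have ha1 := X.a_lt s (effSupport_subset _ _ hs) 1
  obtain ⟨⟨z0, h0⟩, ⟨z1, h1⟩⟩ := two_dvd_of_coeff_ne_zero' hB hℓ hcoeff
  simp only [hsb, smul_zero, add_zero, Finsupp.add_apply, Finsupp.smul_apply, smul_eq_mul, pow_one] at h0 h1
  rw [← hs1]
  exact ⟨hb, by omega, by omega⟩

include hB in
/-- Every effective term has pair key `≤` that of a term of pair `(e₂, 0)`. [folklore] -/
theorem pairKey_le_of_pair (hℓ : 1 ≤ ℓ) {t : ExpTriple 3} (ht1 : t.1 = Finsupp.single 2 1) (ht2 : t.2.1 = 0) :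
    ∀ s ∈ effSupport X.support X.u, pairKey s ≤ pairKey t := by
  intro s hs
  obtain ⟨hsb, hs0, hs1⟩ := shape_of_mem_effSupport' hB X hℓ hs
  have ha2 := X.a_lt s (effSupport_subset _ _ hs) 2
  by_cases h2 : s.1 2 = 1
  · have hs' : s.1 = Finsupp.single 2 1 := by
      ext i
      fin_cases i
      · simpa using hs0
      · simpa using hs1
      · simpa using h2
    rw [pairKey_eq_of_eq (hs'.trans ht1.symm) (hsb.trans ht2.symm)]
  · have hs' : s.1 = 0 := by
      ext i
      fin_cases i
      · simpa using hs0
      · simpa using hs1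
      · have h0 : s.1 2 = 0 := by omega
        simpa using h0
    unfold pairKey
    rw [hs', hsb, ht1, ht2, Prod.Lex.toLex_le_toLex]
    left
    exact lt_of_le_of_ne (Finsupp.toLex_monotone (by intro i; simp)) (by
      intro heq
      have := DFunLike.congr_fun (toLex_inj.1 heq) 2
      simp at this)

include hB in
/-- **The top-block member of total degree `p^ℓ`.** For `ℓ ≥ 2`, every standard expression of every
`ε′ ≡ E_SB (mod M_<^span)` has `(α, β) = (e₂, 0)` and the TOP-BLOCK term `(e₂, 0, (0, 2^{ℓ−1} − 1, 1))` — inside the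
Frobenius box (`2c = (0, 2^ℓ − 2, 2)`) but of total degree `|2c| = 2^ℓ = p^ℓ`.
[cite: Hironaka2017, Lem. 9.5 p.50 l.11–14 (kernel certificate about OUR model; not a verdict)] -/
theorem exists_topBlock_degree_ge (hℓ : 2 ≤ ℓ) :
    alpha X.support X.u = Finsupp.single 2 1 ∧ beta X.support X.u = 0 ∧
      ∃ t ∈ topBlock X.support X.u, (2 • t.2.2) 1 = 2 ^ ℓ - 2 ∧ (2 • t.2.2) 2 = 2 ∧ (2 • t.2.2).degree = 2 ^ ℓ := by
  have h4 : 4 ≤ 2 ^ ℓ := le_trans (by norm_num : 4 ≤ 2 ^ 2) (Nat.pow_le_pow_right (by norm_num) hℓ)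
  have hpow : 2 ^ ℓ = 2 * 2 ^ (ℓ - 1) := by rw [← pow_succ', Nat.sub_add_cancel (by omega : 1 ≤ ℓ)]
  have hcoeff : coeff (Finsupp.single (1 : Fin 3) (2 ^ ℓ - 2) + Finsupp.single 2 3) ε' ≠ 0 := by
    rw [coeff_rayMonoSB_eq_one hB hℓ]
    exact one_ne_zero
  obtain ⟨t, ht, k, hk⟩ := exists_mem_effSupport_of_coeff_ne_zero' X hcoeff
  have hb : t.2.1 = 0 := snd_fst_eq_zero X (effSupport_subset _ _ ht)
  have ha := fun i => X.a_lt t (effSupport_subset _ _ ht) i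
  have e0 : 0 = t.1 0 + 2 * t.2.2 0 + 2 ^ ℓ * k 0 := by
    have h := DFunLike.congr_fun hk 0
    simpa only [Finsupp.add_apply, Finsupp.smul_apply, smul_eq_mul, hb, Finsupp.coe_zero, Pi.zero_apply, mul_zero,
      add_zero, pow_one, Finsupp.single_eq_of_ne n01, Finsupp.single_eq_of_ne n02] using h
  have e1 : 2 ^ ℓ - 2 = t.1 1 + 2 * t.2.2 1 + 2 ^ ℓ * k 1 := by
    have h := DFunLike.congr_fun hk 1
    simpa only [Finsupp.add_apply, Finsupp.smul_apply, smul_eq_mul, hb, Finsupp.coe_zero, Pi.zero_apply, mul_zero,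
      add_zero, pow_one, Finsupp.single_eq_same, Finsupp.single_eq_of_ne n12] using h
  have e2 : 3 = t.1 2 + 2 * t.2.2 2 + 2 ^ ℓ * k 2 := by
    have h := DFunLike.congr_fun hk 2
    simpa only [Finsupp.add_apply, Finsupp.smul_apply, smul_eq_mul, hb, Finsupp.coe_zero, Pi.zero_apply, mul_zero,
      add_zero, pow_one, Finsupp.single_eq_same, Finsupp.single_eq_of_ne n21, zero_add] using h
  have hk1 : k 1 = 0 := (Nat.eq_zero_or_pos (k 1)).resolve_right fun h => by
    have : 2 ^ ℓ ≤ 2 ^ ℓ * k 1 := Nat.le_mul_of_pos_right _ h; omega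
  have hk2 : k 2 = 0 := (Nat.eq_zero_or_pos (k 2)).resolve_right fun h => by
    have : 2 ^ ℓ ≤ 2 ^ ℓ * k 2 := Nat.le_mul_of_pos_right _ h; omega
  rw [hk1, mul_zero, add_zero] at e1
  rw [hk2, mul_zero, add_zero] at e2
  have ha0 := ha 0; have ha1 := ha 1; have ha2 := ha 2
  obtain ⟨ht0, ht1', ht2', hc0, hc1, hc2⟩ : t.1 0 = 0 ∧ t.1 1 = 0 ∧ t.1 2 = 1 ∧ t.2.2 0 = 0 ∧
      2 * t.2.2 1 = 2 ^ ℓ - 2 ∧ t.2.2 2 = 1 := by omega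
  have ht1 : t.1 = Finsupp.single 2 1 := by
    ext i
    fin_cases i
    · simpa using ht0
    · simpa using ht1'
    · simpa using ht2'
  have hmax := pairKey_le_of_pair hB X (by omega) ht1 hb
  have hα : alpha X.support X.u = Finsupp.single 2 1 := by rw [alpha_eq_of_isGreatest _ _ ht hmax, ht1]
  have hβ : beta X.support X.u = 0 := by rw [beta_eq_of_isGreatest _ _ ht hmax, hb]
  refine ⟨hα, hβ, t, (mem_topBlock _ _).2 ⟨ht, by rw [hα, ht1], by rw [hβ, hb]⟩, ?_, ?_, ?_⟩
  · simpa only [Finsupp.smul_apply, smul_eq_mul] using hc1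
  · simp only [Finsupp.smul_apply, smul_eq_mul, hc2]
  · rw [Finsupp.degree_eq_sum, Fin.sum_univ_three]
    simp only [Finsupp.smul_apply, smul_eq_mul, hc0, hc2]
    omega

include hB in
/-- Hence `CampaignW25.DerivOrdersBelowDepth 2 1 ℓ X′` (total degrees `|qγ_j| < p^ℓ`) FAILS for every such `X′`, `ℓ ≥ 2`.
[cite: Hironaka2017, Lem. 9.5 p.50 l.11–14 (kernel certificate about OUR model; not a verdict)] -/
theorem not_derivOrdersBelowDepth (hℓ : 2 ≤ ℓ) : ¬ DerivOrdersBelowDepth 2 1 ℓ X := by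
  obtain ⟨hα, hβ, t, ht, -, -, hdeg⟩ := exists_topBlock_degree_ge hB X hℓ
  have hkey : toLex t.2.2 ∈ gammaKeys X.support X.u := by
    obtain ⟨ht', h1, h2⟩ := (mem_topBlock _ _).1 ht
    rw [mem_gammaKeys, ofLex_toLex]
    have : t = (alpha X.support X.u, beta X.support X.u, t.2.2) := Prod.ext h1 (Prod.ext h2 rfl)
    rwa [← this]
  obtain ⟨j, hj⟩ := exists_gamma_eq hkey
  have hγ : gamma X.support X.u j = t.2.2 := toLex_inj.1 hj
  rintro ⟨-, hD⟩
  have h := hD j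
  rw [hγ, pow_one, hdeg] at h
  exact lt_irrefl _ h

end StdExpr

/-! ## §4 Corollaries: total-degree form NO under the span model; `K25Reduction 2 1 ℓ E_SB` false -/

/-- **K2.5 on SB, TOTAL-DEGREE reading (k25's `SW.AdmissibleTop`), SPAN model, every `ℓ ≥ 2`: NO.** (Box reading, same
model: YES — `SBSpan.existsAdmissibleFiniteRay_box_span`.) [cite: Hironaka2017, Lem. 9.5 p.50 l.11–14 (kernel certificate about OUR model; not a verdict)] -/
theorem not_existsAdmissibleFiniteRay_span {ℓ : ℕ} (hℓ : 2 ≤ ℓ) :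
    ¬ ∃ ε' : MvPowerSeries (Fin 3) 𝔽,
        MemBelowSpan 2 1 ℓ (Finsupp.single (2 : Fin 3) 1) 0
            (ray 2 1 (Finsupp.single (2 : Fin 3) 1) 0 (toFin 𝔽 2 εB)) (toFin 𝔽 2 εB - ε') ∧
          ∃ X : StandardExpression 2 MvPowerSeries.X 1 ℓ ε', AdmissibleTop ℓ X := by
  rintro ⟨ε', hB, X, -, -, -, htop⟩
  obtain ⟨-, -, t, ht, -, -, hdeg⟩ := exists_topBlock_degree_ge hB X hℓ
  exact absurd (htop t ht) (by rw [hdeg]; exact lt_irrefl _)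

/-- **By name: `CampaignW25.K25Reduction 2 1 ℓ E_SB` is FALSE for every `ℓ ≥ 2`** (p502315's typed question: (i) same
pair, (ii) finite `rayOf` AND `DerivOrdersBelowDepth`, (iii) `E_SB − ε′ ∈ M_<^span` of the given expression). A depth-`ℓ`
expression `X₀` of `E_SB` exists (res-D-pv-041's `nonempty_standardExpression_topFrame`), its pair is `(e₂, 0)`
(`SB.topPair_eq`, p505387), and (ii)'s total-degree clause fails for every `X′` by `not_derivOrdersBelowDepth`. SB twin of
res-L1-k25's `SWReduction.not_K25Reduction'` (p505154). [cite: Hironaka2017, Lem. 9.5 p.50 l.11–14 (kernel certificate about OUR model; not a verdict)] -/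
theorem not_K25Reduction {ℓ : ℕ} (hℓ : 2 ≤ ℓ) : ¬ K25Reduction 2 1 ℓ (toFin 𝔽 2 εB) := by
  intro h
  obtain ⟨X₀⟩ := nonempty_standardExpression_topFrame (p := 2) 𝔽 _ 1 ℓ (toFin 𝔽 2 εB)
  obtain ⟨ε', X', -, -, -, hD, hM⟩ := h X₀
  have hB0 : SW.MemBelow 2 1 (Finsupp.single (2 : Fin 3) 1) 0 (toFin 𝔽 2 εB - toFin 𝔽 2 εB) := by
    intro m hm
    rw [sub_self, map_zero] at hm
    exact absurd rfl hm
  obtain ⟨ha, hb⟩ := SB.topPair_eq hB0 X₀ hℓ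
  have hM' : MemBelowSpan 2 1 ℓ (Finsupp.single (2 : Fin 3) 1) 0
      (ray 2 1 (Finsupp.single (2 : Fin 3) 1) 0 (toFin 𝔽 2 εB)) (toFin 𝔽 2 εB - ε') := by
    have : rayOf X₀ = ray 2 1 (alpha X₀.support X₀.u) (beta X₀.support X₀.u) (toFin 𝔽 2 εB) := rfl
    rw [this, ha, hb] at hM
    exact hM
  exact not_derivOrdersBelowDepth hM' X' hℓ hD

/-- `ℓ = 3` by name. [cite: Hironaka2017, Lem. 9.5 p.50 l.11–14 (kernel certificate about OUR model)] -/
theorem not_K25Reduction_three : ¬ K25Reduction 2 1 3 (toFin 𝔽 2 εB) := not_K25Reduction (by norm_num)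
/-- `ℓ = 4` by name. [cite: Hironaka2017, Lem. 9.5 p.50 l.11–14 (kernel certificate about OUR model)] -/
theorem not_K25Reduction_four : ¬ K25Reduction 2 1 4 (toFin 𝔽 2 εB) := not_K25Reduction (by norm_num)

end Summit.ResolutionOfSingularities.ResolutionOfSingularities.Theorems.CampaignW25.SBSpanTotal

end
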